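import Literature.Geometry.Kaehler.ComplexTorusPolarizedDecompositionUnique
import HarnessLib

/-!
# Indecomposable polarised abelian subvarieties: the internal notion agrees with «the sub-torus
# `(Y_U, η|_U)` is not a product of two non-zero polarised tori» (Debarre 1996, «indécomposable»)

Layer `Literature/Geometry/Kaehler`, namespace `Literature.Geometry.Kaehler.ComplexTorus`; lane `lit-hodgefound`,
seat p16, row g14-#1 FILE 3 (rider to `ComplexTorusPolarizedDecompositionUnique`). One plumbing definition
(`subtorusIncl`, the real inclusion `C_ℝ : ℝ^r → Λ ⊗ ℝ` of the sub-torus lattice space) + theorems;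
NO named fact, net debt `0`.

## Source, VERBATIM

O. Debarre, *Polarisations sur les variétés abéliennes produits*, C. R. Acad. Sci. Paris **323** (1996)
631–635 [Debarre1996PolarisationsProduits], p. 631: "On dit qu'une variété abélienne polarisée est
*indécomposable* si elle n'est ni nulle, ni isomorphe au produit de deux variétés abéliennes polarisées
non nulles." — in Corollaire 2 the hypothesis is that the FACTORS `(Xᵢ, θ|Xᵢ)` (polarised abelian
subvarieties with the induced polarisation) are indécomposables.

## What is proved

Row g14-#1 FILE 2 renders «`(X_U, η|U)` indécomposable» internally as `IsIndecomposable Φ η U` (no product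
pair `IsProductPairIn Φ η U V W` with `V, W ≠ 0` inside the complex lattice subspace `U ⊆ Λ ⊗ ℝ`). The
sub-torus itself is the polarised torus `(ComplexTorus (subtorusPeriod Φ U hU hUc), η|_U)` on the lattice
space `ℝ^r`, `r = rk(Λ ∩ U)`, with `η|_U = pullbackForm (cxSpan Φ U).subtypeL η` (skel-1's
`ComplexTorusSubtorusQuotient`; g13-#1's `IsProductPair.exists_isPolarizedIso_addition`). Here we transport
product pairs along the real inclusion `C_ℝ : ℝ^r → Λ ⊗ ℝ` (`x ↦ C x`, `C = subtorusMatrix U`, image `U`,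
`C(ℤ^r) = Λ ∩ U`) in both directions (`IsProductPair.map_subtorusIncl`,
`IsProductPairIn.comap_subtorusIncl`) and conclude **`isIndecomposable_iff_not_isPolarizedDecomposable`**:
`IsIndecomposable Φ η U ↔ U ≠ 0 ∧ ¬ IsPolarizedDecomposable (subtorusPeriod Φ U hU hUc) (η|_U)` — so, by
g13-#1's `isPolarizedDecomposable_of_isPolarizedIso_prod` / `IsPolarizedDecomposable.exists_isPolarizedIso`,
exactly Debarre's «ni nulle, ni isomorphe au produit de deux variétés abéliennes polarisées non nulles»
(`IsIndecomposable.not_isPolarizedIso_prod`; the polarised components of FILE 2 are such,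
`IsRiemannForm.not_isPolarizedDecomposable_of_mem_polarizedComponents`). § 5 makes the uniqueness concrete
for polarised abelian SURFACES: the members of any product pair with non-zero factors are elliptic-curve
factors, hence THE two indecomposable factors (`IsPolarizedDecomposable.exists_polarizedComponents_eq_pair`),
e.g. for g13-#1's `E_i × E_i = A_{ℤ[i]²}` (`exists_polarizedComponents_period_tensorZi_two`).

## References

* [Debarre1996PolarisationsProduits] O. Debarre, C. R. Acad. Sci. Paris 323 (1996) 631–635, p. 631 and
  Corollaire 2.
* [Lange2023AbelianVarietiesComplex] H. Lange, *Abelian Varieties over the Complex Numbers* (2023), §1.1.6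
  Exercise (2)(a) (sub-tori `Λ' ⊗ ℝ → V`), §2.4.4 Cor. 2.4.31, p. 125.
-/

noncomputable section

open Module Function Submodule Complex Set Matrix

namespace Literature.Geometry.Kaehler

namespace ComplexTorus

variable {ι : Type*} [Fintype ι] {E : Type*} [NormedAddCommGroup E] [NormedSpace ℂ E]

/-! ### § 1 The real inclusion `C_ℝ : ℝ^r → Λ ⊗ ℝ` of the sub-torus lattice space -/

section Incl

variable (U : Submodule ℝ (ι → ℝ))

/-- **`C_ℝ : ℝ^r → Λ ⊗ ℝ`, `x ↦ C x`** — "the canonical map `Λ' ⊗ ℝ → V`" of the sub-torus on `U`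
(`C = subtorusMatrix U`, the adapted basis of `Λ' = Λ ∩ U`), as a real linear map.
[cite: Lange2023AbelianVarietiesComplex, §1.1.6 Exercise (2)(a), p. 26] -/
def subtorusIncl : (Fin (subRank U) → ℝ) →ₗ[ℝ] (ι → ℝ) :=
  ((subtorusMatrix U).map (Int.cast : ℤ → ℝ)).mulVecLin

/-- `subtorusIncl U x = C_ℝ x`. [cite: Lange2023AbelianVarietiesComplex, §1.1.6 Exercise (2)(a), p. 26] -/
@[simp] theorem subtorusIncl_apply (x : Fin (subRank U) → ℝ) :
    subtorusIncl U x = (subtorusMatrix U).map (Int.cast : ℤ → ℝ) *ᵥ x := rfl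

/-- `C_ℝ` is injective. [cite: Lange2023AbelianVarietiesComplex, §1.1.6 Exercise (2)(a), p. 26] -/
theorem subtorusIncl_injective : Injective (subtorusIncl U) :=
  subtorusMatrix_mulVec_injective U

variable {U}

/-- `C_ℝ(ℝ^r) = U` for a lattice subspace `U`. [cite: Lange2023AbelianVarietiesComplex, §1.1.6 Exercise (2)(a), p. 26] -/
theorem range_subtorusIncl (hU : IsLatticeSubspace U) : LinearMap.range (subtorusIncl U) = U :=
  range_subtorusMatrix_mulVecLin hU

variable (U)

/-- `C_ℝ` maps lattice vectors to lattice vectors: `C_ℝ(c) = C c`. [cite: Lange2023AbelianVarietiesComplex, §1.1.3 (1.3), p. 23] -/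
theorem subtorusIncl_intVec (c : Fin (subRank U) → ℤ) :
    subtorusIncl U (intVec c) = intVec (subtorusMatrix U *ᵥ c) := by
  rw [subtorusIncl_apply, intVec_mulVec]

/-- `C(ℤ^r) = Λ ∩ U`: every lattice vector of `U` is `C c` for an integer vector `c`.
[cite: Lange2023AbelianVarietiesComplex, §1.4.1 Prop. 1.4.2 (proof), p. 43] -/
theorem exists_eq_subtorusMatrix_mulVec {m : ι → ℤ} (hm : m ∈ subLattice U) :
    ∃ c : Fin (subRank U) → ℤ, subtorusMatrix U *ᵥ c = m := by
  have : m ∈ LinearMap.range (subtorusMatrix U).mulVecLin := by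
    rw [range_subtorusMatrix_mulVecLin_eq_subLattice]; exact hm
  obtain ⟨c, hc⟩ := this
  exact ⟨c, hc⟩

/-- `C c ∈ Λ ∩ U` (a private copy of the tree's `subtorusMatrix_mulVec_mem_subLattice` of
`ComplexTorusSubtorusSelfIntersectionFormula`, not imported here). [folklore] -/
private theorem subtorusMatrix_mulVec_mem_subLattice₃ (c : Fin (subRank U) → ℤ) :
    subtorusMatrix U *ᵥ c ∈ subLattice U := by
  rw [← range_subtorusMatrix_mulVecLin_eq_subLattice]
  exact ⟨c, rfl⟩

/-- `C` is injective on integer vectors. [cite: Lange2023AbelianVarietiesComplex, §1.4.1 Prop. 1.4.2 (proof: `R C = 1`), p. 43] -/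
theorem subtorusMatrix_mulVec_injective_int : Injective fun c : Fin (subRank U) → ℤ ↦ subtorusMatrix U *ᵥ c := by
  intro c c' h
  have h' : intVec (subtorusMatrix U *ᵥ c) = intVec (subtorusMatrix U *ᵥ c') := congrArg intVec h
  rw [← subtorusIncl_intVec, ← subtorusIncl_intVec] at h'
  have h'' := subtorusIncl_injective U h'
  funext i
  have := congrFun h'' i
  simp only [intVec] at this
  exact_mod_cast this

variable {U} (Φ : (ι → ℝ) ≃L[ℝ] E)

/-- The sub-torus period map is `Φ ∘ C_ℝ`: `Ψ_U(x) = Φ(C_ℝ x)` in `E`.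
[cite: Lange2023AbelianVarietiesComplex, §1.1.6 Exercise (2)(a), p. 26] -/
theorem coe_subtorusPeriod_eq (hU : IsLatticeSubspace U) (hUc : IsComplexSubspace Φ U)
    (x : Fin (subRank U) → ℝ) : (subtorusPeriod Φ U hU hUc x : E) = Φ (subtorusIncl U x) := rfl

/-- `C_ℝ(Ψ_U⁻¹ z) = Φ⁻¹ z` for `z ∈ Φ(U)`. [cite: Lange2023AbelianVarietiesComplex, §1.1.6 Exercise (2)(a), p. 26] -/
theorem subtorusIncl_symm_apply (hU : IsLatticeSubspace U) (hUc : IsComplexSubspace Φ U) (z : cxSpan Φ U) :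
    subtorusIncl U ((subtorusPeriod Φ U hU hUc).symm z) = Φ.symm (z : E) := by
  apply Φ.injective
  rw [← coe_subtorusPeriod_eq Φ hU hUc, ContinuousLinearEquiv.apply_symm_apply,
    ContinuousLinearEquiv.apply_symm_apply]

/-- **The complex structures match**: `C_ℝ(J_U x) = J(C_ℝ x)` for the complex structures `J_U = Ψ_U⁻¹ i Ψ_U`
of `ℝ^r` and `J = Φ⁻¹ i Φ` of `Λ ⊗ ℝ`. [cite: Lange2023AbelianVarietiesComplex, §1.1.6 Exercise (2)(a), p. 26] -/
theorem subtorusIncl_J (hU : IsLatticeSubspace U) (hUc : IsComplexSubspace Φ U) (x : Fin (subRank U) → ℝ) :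
    subtorusIncl U ((subtorusPeriod Φ U hU hUc).symm (I • subtorusPeriod Φ U hU hUc x)) =
      Φ.symm (I • Φ (subtorusIncl U x)) := by
  rw [subtorusIncl_symm_apply Φ hU hUc, Submodule.coe_smul, coe_subtorusPeriod_eq Φ hU hUc]

/-- The induced form: `η|_U(Ψ_U x, Ψ_U y) = η(Φ C_ℝ x, Φ C_ℝ y)`. [cite: Lange2023AbelianVarietiesComplex, §2.4.4 Cor. 2.4.24 ("`L|_Y`"), p. 123] -/
theorem pullbackForm_subtorusPeriod (η : E [⋀^Fin 2]→L[ℝ] ℝ) (hU : IsLatticeSubspace U)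
    (hUc : IsComplexSubspace Φ U) (x y : Fin (subRank U) → ℝ) :
    pullbackForm (cxSpan Φ U).subtypeL η ![subtorusPeriod Φ U hU hUc x, subtorusPeriod Φ U hU hUc y] =
      η ![Φ (subtorusIncl U x), Φ (subtorusIncl U y)] := by
  rw [pullbackForm_apply]
  rfl

end Incl

/-! ### § 2 Product pairs of the sub-torus ⟶ product pairs inside `U` -/

section MapDown

variable {Φ : (ι → ℝ) ≃L[ℝ] E} {η : E [⋀^Fin 2]→L[ℝ] ℝ} {U : Submodule ℝ (ι → ℝ)}

/-- `C_ℝ` carries lattice subspaces of `ℝ^r` to lattice subspaces of `Λ ⊗ ℝ`.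
[cite: Lange2023AbelianVarietiesComplex, §1.1.6 Exercise (2)(a), p. 26] -/
theorem IsLatticeSubspace.map_subtorusIncl {V' : Submodule ℝ (Fin (subRank U) → ℝ)}
    (hV' : IsLatticeSubspace V') : IsLatticeSubspace (V'.map (subtorusIncl U)) := by
  obtain ⟨S, rfl⟩ := hV'
  refine ⟨(fun c ↦ subtorusMatrix U *ᵥ c) '' S, ?_⟩
  rw [Submodule.map_span, Set.image_image, Set.image_image]
  congr 1
  exact Set.image_congr' fun c ↦ subtorusIncl_intVec U c

/-- `C_ℝ` carries `J_U`-complex subspaces to `J`-complex subspaces.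
[cite: Lange2023AbelianVarietiesComplex, §1.1.6 Exercise (2)(a), p. 26] -/
theorem IsComplexSubspace.map_subtorusIncl (hU : IsLatticeSubspace U) (hUc : IsComplexSubspace Φ U)
    {V' : Submodule ℝ (Fin (subRank U) → ℝ)} (hV' : IsComplexSubspace (subtorusPeriod Φ U hU hUc) V') :
    IsComplexSubspace Φ (V'.map (subtorusIncl U)) := by
  rintro _ ⟨x, hx, rfl⟩
  exact ⟨_, hV' x hx, subtorusIncl_J Φ hU hUc x⟩

/-- Lattice points of `C_ℝ(V')` are the `C c` with `c` a lattice point of `V'`.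
[cite: Lange2023AbelianVarietiesComplex, §1.4.1 Prop. 1.4.2 (proof), p. 43] -/
theorem mem_subLattice_map_subtorusIncl_iff {V' : Submodule ℝ (Fin (subRank U) → ℝ)}
    {c : Fin (subRank U) → ℤ} :
    subtorusMatrix U *ᵥ c ∈ subLattice (V'.map (subtorusIncl U)) ↔ c ∈ subLattice V' := by
  rw [mem_subLattice_iff, mem_subLattice_iff, ← subtorusIncl_intVec]
  constructor
  · rintro ⟨y, hy, hyx⟩
    rwa [← subtorusIncl_injective U hyx]
  · exact fun h ↦ ⟨_, h, rfl⟩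

/-- **A product pair of the polarised sub-torus `(Y_U, η|_U)` gives a product pair inside `U`**, by `C_ℝ`.
[cite: Debarre1996PolarisationsProduits, p. 631 («indécomposable») and Corollaire 2]
[cite: Lange2023AbelianVarietiesComplex, §2.4.4 Cor. 2.4.31, p. 125] -/
theorem IsProductPair.map_subtorusIncl (hU : IsLatticeSubspace U) (hUc : IsComplexSubspace Φ U)
    {V' W' : Submodule ℝ (Fin (subRank U) → ℝ)}
    (hp : IsProductPair (subtorusPeriod Φ U hU hUc) (pullbackForm (cxSpan Φ U).subtypeL η) V' W') :
    IsProductPairIn Φ η U (V'.map (subtorusIncl U)) (W'.map (subtorusIncl U)) where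
  isLatticeSubspace_left := hp.isLatticeSubspace_left.map_subtorusIncl
  isComplexSubspace_left := IsComplexSubspace.map_subtorusIncl hU hUc hp.isComplexSubspace_left
  isLatticeSubspace_right := hp.isLatticeSubspace_right.map_subtorusIncl
  isComplexSubspace_right := IsComplexSubspace.map_subtorusIncl hU hUc hp.isComplexSubspace_right
  disjoint := by
    rw [disjoint_iff, ← Submodule.map_inf _ (subtorusIncl_injective U), hp.isCompl.inf_eq_bot,
      Submodule.map_bot]
  sup_eq := by
    rw [← Submodule.map_sup, hp.isCompl.sup_eq_top, Submodule.map_top, range_subtorusIncl hU]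
  orthogonal := by
    rintro _ ⟨x, hx, rfl⟩ _ ⟨y, hy, rfl⟩
    rw [← pullbackForm_subtorusPeriod Φ η hU hUc]
    exact hp.orthogonal x hx y hy
  sup_subLattice := by
    refine le_antisymm (sup_le ?_ ?_) fun m hm ↦ ?_
    · intro m hm
      rw [mem_subLattice_iff] at hm ⊢
      exact (range_subtorusIncl hU).le (LinearMap.map_le_range hm)
    · intro m hm
      rw [mem_subLattice_iff] at hm ⊢
      exact (range_subtorusIncl hU).le (LinearMap.map_le_range hm)
    · obtain ⟨c, rfl⟩ := exists_eq_subtorusMatrix_mulVec U hm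
      have hc : c ∈ subLattice V' ⊔ subLattice W' := by rw [hp.sup_subLattice]; exact mem_top
      obtain ⟨c₁, hc₁, c₂, hc₂, rfl⟩ := mem_sup.1 hc
      rw [Matrix.mulVec_add]
      exact add_mem (mem_sup_left (mem_subLattice_map_subtorusIncl_iff.2 hc₁))
        (mem_sup_right (mem_subLattice_map_subtorusIncl_iff.2 hc₂))

/-- `C_ℝ(V') = 0 ↔ V' = 0`. [cite: Lange2023AbelianVarietiesComplex, §1.1.6 Exercise (2)(a), p. 26] -/
theorem map_subtorusIncl_eq_bot_iff {V' : Submodule ℝ (Fin (subRank U) → ℝ)} :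
    V'.map (subtorusIncl U) = ⊥ ↔ V' = ⊥ := by
  constructor
  · intro h
    rw [eq_bot_iff]
    intro x hx
    have hx' : subtorusIncl U x ∈ (⊥ : Submodule ℝ (ι → ℝ)) := h ▸ Submodule.mem_map_of_mem hx
    rw [mem_bot] at hx' ⊢
    exact subtorusIncl_injective U (by rw [hx', map_zero])
  · rintro rfl
    exact Submodule.map_bot _

end MapDown

/-! ### § 3 Product pairs inside `U` ⟶ product pairs of the sub-torus -/

section MapUp

variable {Φ : (ι → ℝ) ≃L[ℝ] E} {η : E [⋀^Fin 2]→L[ℝ] ℝ} {U : Submodule ℝ (ι → ℝ)}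

omit [Fintype ι] in
/-- `subLattice` is monotone. [folklore] -/
private theorem subLattice_mono₃ {V W : Submodule ℝ (ι → ℝ)} (h : V ≤ W) : subLattice V ≤ subLattice W :=
  fun _ hm ↦ h hm

/-- Lattice points of `C_ℝ⁻¹(V)` are the `c` with `C c ∈ Λ ∩ V`.
[cite: Lange2023AbelianVarietiesComplex, §1.4.1 Prop. 1.4.2 (proof), p. 43] -/
theorem mem_subLattice_comap_subtorusIncl_iff {V : Submodule ℝ (ι → ℝ)} {c : Fin (subRank U) → ℤ} :
    c ∈ subLattice (V.comap (subtorusIncl U)) ↔ subtorusMatrix U *ᵥ c ∈ subLattice V := by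
  rw [mem_subLattice_iff, mem_subLattice_iff, Submodule.mem_comap, subtorusIncl_intVec]

/-- `C_ℝ⁻¹` carries lattice subspaces `V ⊆ U` to lattice subspaces of `ℝ^r` (every lattice vector of `V`
is `C c`). [cite: Lange2023AbelianVarietiesComplex, §1.1.6 Exercise (2)(a), p. 26] -/
theorem IsLatticeSubspace.comap_subtorusIncl {V : Submodule ℝ (ι → ℝ)} (hV : IsLatticeSubspace V)
    (hVU : V ≤ U) : IsLatticeSubspace (V.comap (subtorusIncl U)) := by
  set S' : Set (Fin (subRank U) → ℤ) := {c | subtorusMatrix U *ᵥ c ∈ subLattice V} with hS'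
  have himage : intVec '' (subLattice V : Set (ι → ℤ)) = subtorusIncl U '' (intVec '' S') := by
    apply Set.Subset.antisymm
    · rintro _ ⟨m, hm, rfl⟩
      obtain ⟨c, rfl⟩ := exists_eq_subtorusMatrix_mulVec U (subLattice_mono₃ hVU hm)
      exact ⟨intVec c, ⟨c, hm, rfl⟩, subtorusIncl_intVec U c⟩
    · rintro _ ⟨_, ⟨c, hc, rfl⟩, rfl⟩
      exact ⟨_, hc, (subtorusIncl_intVec U c).symm⟩
  refine ⟨S', le_antisymm (fun x hx ↦ ?_) (span_le.2 ?_)⟩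
  · rw [Submodule.mem_comap, ← span_intVec_subLattice hV, himage, ← Submodule.map_span] at hx
    obtain ⟨y, hy, hyx⟩ := hx
    rwa [← subtorusIncl_injective U hyx]
  · rintro _ ⟨c, hc, rfl⟩
    change subtorusIncl U (intVec c) ∈ V
    rw [subtorusIncl_intVec]
    exact hc

/-- `C_ℝ⁻¹` carries `J`-complex subspaces to `J_U`-complex subspaces.
[cite: Lange2023AbelianVarietiesComplex, §1.1.6 Exercise (2)(a), p. 26] -/
theorem IsComplexSubspace.comap_subtorusIncl {V : Submodule ℝ (ι → ℝ)} (hVc : IsComplexSubspace Φ V)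
    (hU : IsLatticeSubspace U) (hUc : IsComplexSubspace Φ U) :
    IsComplexSubspace (subtorusPeriod Φ U hU hUc) (V.comap (subtorusIncl U)) := by
  intro x hx
  rw [Submodule.mem_comap] at hx ⊢
  rw [subtorusIncl_J Φ hU hUc]
  exact hVc _ hx

/-- **A product pair inside `U` gives a product pair of the polarised sub-torus `(Y_U, η|_U)`**, by `C_ℝ⁻¹`.
[cite: Debarre1996PolarisationsProduits, p. 631 («indécomposable») and Corollaire 2]
[cite: Lange2023AbelianVarietiesComplex, §2.4.4 Cor. 2.4.31, p. 125] -/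
theorem IsProductPairIn.comap_subtorusIncl (hU : IsLatticeSubspace U) (hUc : IsComplexSubspace Φ U)
    {V W : Submodule ℝ (ι → ℝ)} (hp : IsProductPairIn Φ η U V W) :
    IsProductPair (subtorusPeriod Φ U hU hUc) (pullbackForm (cxSpan Φ U).subtypeL η)
      (V.comap (subtorusIncl U)) (W.comap (subtorusIncl U)) where
  isLatticeSubspace_left := hp.isLatticeSubspace_left.comap_subtorusIncl (hp.sup_eq ▸ le_sup_left)
  isComplexSubspace_left := hp.isComplexSubspace_left.comap_subtorusIncl hU hUc
  isLatticeSubspace_right := hp.isLatticeSubspace_right.comap_subtorusIncl (hp.sup_eq ▸ le_sup_right)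
  isComplexSubspace_right := hp.isComplexSubspace_right.comap_subtorusIncl hU hUc
  isCompl := by
    refine ⟨?_, codisjoint_iff.2 ?_⟩
    · rw [disjoint_iff, ← Submodule.comap_inf, hp.disjoint.eq_bot, Submodule.comap_bot,
        LinearMap.ker_eq_bot.2 (subtorusIncl_injective U)]
    · rw [eq_top_iff]
      intro x _
      have hx : subtorusIncl U x ∈ V ⊔ W := by
        rw [hp.sup_eq]
        exact (range_subtorusIncl hU).le ⟨x, rfl⟩
      obtain ⟨v, hv, w, hw, hvw⟩ := mem_sup.1 hx
      obtain ⟨x₁, rfl⟩ : v ∈ LinearMap.range (subtorusIncl U) := by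
        rw [range_subtorusIncl hU, ← hp.sup_eq]; exact mem_sup_left hv
      obtain ⟨x₂, rfl⟩ : w ∈ LinearMap.range (subtorusIncl U) := by
        rw [range_subtorusIncl hU, ← hp.sup_eq]; exact mem_sup_right hw
      rw [← map_add] at hvw
      rw [← subtorusIncl_injective U hvw]
      exact add_mem (mem_sup_left hv) (mem_sup_right hw)
  orthogonal x hx y hy := by
    rw [pullbackForm_subtorusPeriod Φ η hU hUc]
    exact hp.orthogonal _ hx _ hy
  sup_subLattice := by
    rw [eq_top_iff]
    intro c _
    have hm : subtorusMatrix U *ᵥ c ∈ subLattice V ⊔ subLattice W := by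
      rw [hp.sup_subLattice]; exact subtorusMatrix_mulVec_mem_subLattice₃ U c
    obtain ⟨m₁, hm₁, m₂, hm₂, hsum⟩ := mem_sup.1 hm
    obtain ⟨c₁, rfl⟩ := exists_eq_subtorusMatrix_mulVec U (subLattice_mono₃ (hp.sup_eq ▸ le_sup_left) hm₁)
    obtain ⟨c₂, rfl⟩ := exists_eq_subtorusMatrix_mulVec U (subLattice_mono₃ (hp.sup_eq ▸ le_sup_right) hm₂)
    rw [← Matrix.mulVec_add] at hsum
    rw [← subtorusMatrix_mulVec_injective_int U hsum]
    exact add_mem (mem_sup_left (mem_subLattice_comap_subtorusIncl_iff.2 hm₁))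
      (mem_sup_right (mem_subLattice_comap_subtorusIncl_iff.2 hm₂))

/-- `C_ℝ⁻¹(V) = 0 ↔ V = 0` for `V ⊆ U`. [cite: Lange2023AbelianVarietiesComplex, §1.1.6 Exercise (2)(a), p. 26] -/
theorem comap_subtorusIncl_eq_bot_iff (hU : IsLatticeSubspace U) {V : Submodule ℝ (ι → ℝ)} (hVU : V ≤ U) :
    V.comap (subtorusIncl U) = ⊥ ↔ V = ⊥ := by
  constructor
  · intro h
    rw [eq_bot_iff]
    intro v hv
    obtain ⟨x, rfl⟩ : v ∈ LinearMap.range (subtorusIncl U) := by rw [range_subtorusIncl hU]; exact hVU hv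
    have hx : x ∈ V.comap (subtorusIncl U) := hv
    rw [h, mem_bot] at hx
    rw [hx, map_zero]
    exact zero_mem _
  · rintro rfl
    rw [Submodule.comap_bot]
    exact LinearMap.ker_eq_bot.2 (subtorusIncl_injective U)

end MapUp

/-! ### § 4 «indécomposable»: internal = the sub-torus is not a product -/

section Main

variable {Φ : (ι → ℝ) ≃L[ℝ] E} {η : E [⋀^Fin 2]→L[ℝ] ℝ} {U : Submodule ℝ (ι → ℝ)}

/-- **The internal and the sub-torus notions of «indécomposable» agree**: the polarised abelian subvariety
on `U` is indecomposable (no product pair inside `U`) iff `U ≠ 0` and the polarised sub-torus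
`(Y_U, η|_U) = (ComplexTorus (subtorusPeriod Φ U hU hUc), η|_U)` is not decomposable in the sense of
g13-#1 — i.e. (by `IsPolarizedDecomposable.exists_isPolarizedIso` /
`isPolarizedDecomposable_of_isPolarizedIso_prod`) "ni nulle, ni isomorphe au produit de deux variétés
abéliennes polarisées non nulles". [cite: Debarre1996PolarisationsProduits, p. 631 (definition of «indécomposable»)] -/
theorem isIndecomposable_iff_not_isPolarizedDecomposable (hU : IsLatticeSubspace U)
    (hUc : IsComplexSubspace Φ U) :
    IsIndecomposable Φ η U ↔
      U ≠ ⊥ ∧ ¬ IsPolarizedDecomposable (subtorusPeriod Φ U hU hUc) (pullbackForm (cxSpan Φ U).subtypeL η) := by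
  constructor
  · rintro ⟨hU0, -, -, hind⟩
    refine ⟨hU0, ?_⟩
    rintro ⟨V', W', hV', hW', hp⟩
    rcases hind _ _ (hp.map_subtorusIncl hU hUc) with h | h
    · exact hV' (map_subtorusIncl_eq_bot_iff.1 h)
    · exact hW' (map_subtorusIncl_eq_bot_iff.1 h)
  · rintro ⟨hU0, hnd⟩
    refine ⟨hU0, hU, hUc, fun V W hp ↦ ?_⟩
    by_contra hne
    push Not at hne
    exact hnd ⟨_, _, fun h ↦ hne.1 ((comap_subtorusIncl_eq_bot_iff hU (hp.sup_eq ▸ le_sup_left)).1 h),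
      fun h ↦ hne.2 ((comap_subtorusIncl_eq_bot_iff hU (hp.sup_eq ▸ le_sup_right)).1 h),
      hp.comap_subtorusIncl hU hUc⟩

/-- **«ni isomorphe au produit de deux variétés abéliennes polarisées non nulles»**: the polarised sub-torus of
an indecomposable `U` is not isomorphic, as a polarised torus, to any product `(X₁ × X₂, ω₁ ⊞ ω₂)` of two
positive-dimensional polarised tori. [cite: Debarre1996PolarisationsProduits, p. 631 (definition of «indécomposable»)] -/
theorem IsIndecomposable.not_isPolarizedIso_prod (h : IsIndecomposable Φ η U) {ι₁ ι₂ : Type*} [Fintype ι₁]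
    [Fintype ι₂] [DecidableEq ι₁] [DecidableEq ι₂] [Nonempty ι₁] [Nonempty ι₂] {E₁ E₂ : Type*}
    [NormedAddCommGroup E₁] [NormedSpace ℂ E₁] [NormedAddCommGroup E₂] [NormedSpace ℂ E₂]
    (Φ₁ : (ι₁ → ℝ) ≃L[ℝ] E₁) (Φ₂ : (ι₂ → ℝ) ≃L[ℝ] E₂) (ω₁ : E₁ [⋀^Fin 2]→L[ℝ] ℝ) (ω₂ : E₂ [⋀^Fin 2]→L[ℝ] ℝ)
    (f : ComplexTorus (subtorusPeriod Φ U h.2.1 h.2.2.1) ≃+ ComplexTorus (prodPeriod Φ₁ Φ₂)) :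
    ¬ IsPolarizedIso (subtorusPeriod Φ U h.2.1 h.2.2.1) (pullbackForm (cxSpan Φ U).subtypeL η)
        (prodPeriod Φ₁ Φ₂) (prodForm ω₁ ω₂) f := fun hf ↦
  ((isIndecomposable_iff_not_isPolarizedDecomposable h.2.1 h.2.2.1).1 h).2
    (isPolarizedDecomposable_of_isPolarizedIso_prod Φ₁ Φ₂ ω₁ ω₂ hf)

/-- **The polarised components of FILE 2 are indecomposable polarised tori in the sub-torus sense.**
[cite: Debarre1996PolarisationsProduits, p. 631] -/
theorem IsRiemannForm.not_isPolarizedDecomposable_of_mem_polarizedComponents [DecidableEq ι]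
    (hη : IsRiemannForm Φ η) {V : Submodule ℝ (ι → ℝ)} (hV : V ∈ polarizedComponents Φ η) :
    ¬ IsPolarizedDecomposable
        (subtorusPeriod Φ V (hη.isIndecomposable_of_mem_polarizedComponents hV).2.1
          (hη.isIndecomposable_of_mem_polarizedComponents hV).2.2.1)
        (pullbackForm (cxSpan Φ V).subtypeL η) :=
  ((isIndecomposable_iff_not_isPolarizedDecomposable _ _).1
    (hη.isIndecomposable_of_mem_polarizedComponents hV)).2

/-- Conversely, a non-zero complex lattice subspace whose polarised sub-torus is not decomposable is an
indecomposable factor. [cite: Debarre1996PolarisationsProduits, p. 631 (definition of «indécomposable»)] -/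
theorem isIndecomposable_of_not_isPolarizedDecomposable (hU : IsLatticeSubspace U) (hUc : IsComplexSubspace Φ U)
    (hU0 : U ≠ ⊥)
    (h : ¬ IsPolarizedDecomposable (subtorusPeriod Φ U hU hUc) (pullbackForm (cxSpan Φ U).subtypeL η)) :
    IsIndecomposable Φ η U :=
  (isIndecomposable_iff_not_isPolarizedDecomposable hU hUc).2 ⟨hU0, h⟩

end Main

/-! ### § 5 Polarised abelian surfaces: the factors of a decomposable surface are its two unique
indecomposable factors; `E_i × E_i` -/

section Surfaces

variable {Φ : (ι → ℝ) ≃L[ℝ] E} {η : E [⋀^Fin 2]→L[ℝ] ℝ}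

/-- On a polarised torus of dimension `2` (`rk Λ = 4`) both members of a product pair with non-zero factors
are elliptic-curve factors (`dim_ℝ = 2`). [cite: Debarre1996PolarisationsProduits, Corollaire 2 b)] -/
theorem IsProductPair.finrank_eq_two_of_card_eq_four {V W : Submodule ℝ (ι → ℝ)} (hp : IsProductPair Φ η V W)
    (h4 : Fintype.card ι = 4) (hV : V ≠ ⊥) (hW : W ≠ ⊥) : finrank ℝ V = 2 ∧ finrank ℝ W = 2 := by
  have hV2 := two_le_finrank_of_isComplexSubspace hp.isLatticeSubspace_left hp.isComplexSubspace_left hV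
  have hW2 := two_le_finrank_of_isComplexSubspace hp.isLatticeSubspace_right hp.isComplexSubspace_right hW
  have hsum := Submodule.finrank_sup_add_finrank_inf_eq V W
  rw [hp.isCompl.sup_eq_top, hp.isCompl.inf_eq_bot, finrank_top, finrank_bot, add_zero,
    Module.finrank_fintype_fun_eq_card, h4] at hsum
  omega

/-- **A decomposable polarised abelian surface has exactly two indecomposable factors, the members of any
of its product pairs** (uniqueness made concrete in dimension `2`).
[cite: Debarre1996PolarisationsProduits, Corollaire 2 b)] -/
theorem IsPolarizedDecomposable.exists_polarizedComponents_eq_pair [DecidableEq ι] (hd : IsPolarizedDecomposable Φ η)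
    (hη : IsRiemannForm Φ η) (h4 : Fintype.card ι = 4) :
    ∃ V W : Submodule ℝ (ι → ℝ), V ≠ W ∧ IsProductPair Φ η V W ∧ polarizedComponents Φ η = {V, W} := by
  obtain ⟨V, W, hV, hW, hp⟩ := hd
  obtain ⟨hV2, hW2⟩ := hp.finrank_eq_two_of_card_eq_four h4 hV hW
  refine ⟨V, W, ?_, hp, hp.polarizedComponents_eq_pair
    (isIndecomposable_of_finrank_eq_two hp.isLatticeSubspace_left hp.isComplexSubspace_left hV2)
    (isIndecomposable_of_finrank_eq_two hp.isLatticeSubspace_right hp.isComplexSubspace_right hW2) hη⟩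
  rintro rfl
  exact hV (disjoint_self.1 hp.isCompl.disjoint)

open Literature.Geometry.Kaehler.GaussianLattice Literature.LinearAlgebra.QuadraticForm.GaussianLattice in
/-- **`A_{ℤ[i]²} = E_i × E_i` with its product principal polarisation has exactly two indecomposable
polarised factors** — g13-#1's decomposable example (`isPolarizedDecomposable_period_tensorZi_two`) seen
through Corollaire 2 b). [cite: Debarre1996PolarisationsProduits, Corollaire 2 b)]
[cite: Beauville2013GaussianLattices, §1.2 Example 3 and §1.3, p. 3] -/
theorem exists_polarizedComponents_period_tensorZi_two :
    ∃ V W : Submodule ℝ (Fin 2 ⊕ Fin 2 → ℝ), V ≠ W ∧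
      IsProductPair (period (tensorZiJ_mul_self (κ := Fin 2)))
        (polarization (tensorZiJ_mul_self (κ := Fin 2)) (tensorZiS_isSymm Matrix.isSymm_one)
          (tensorZiJ_transpose_mul 1)) V W ∧
      polarizedComponents (period (tensorZiJ_mul_self (κ := Fin 2)))
        (polarization (tensorZiJ_mul_self (κ := Fin 2)) (tensorZiS_isSymm Matrix.isSymm_one)
          (tensorZiJ_transpose_mul 1)) = {V, W} :=
  isPolarizedDecomposable_period_tensorZi_two.exists_polarizedComponents_eq_pair
    (isRiemannForm_polarization _ _ _ posDef_tensorZiS_one) (by simp)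

end Surfaces

end ComplexTorus

end Literature.Geometry.Kaehler

end
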